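import Mathlib
import HarnessLib
import Literature.Computability.AlgebraicComplexity.PatternExpressions
import Literature.Combinatorics.SimpleGraph.TreeDecomposition
import Summits.ValiantsHypothesis.ValiantsHypothesis.Theorems.MonotoneRestorationOrbitRestorationQPHomSpan

/-!
# Route MonotoneRestoration, crux `MonotoneRestorationQP` (stmt-15886), line `linear-width` —
# LOVÁSZ'S THEOREM FOR COMPLEX EDGE-WEIGHTED BIPARTITE GRAPHS: hom-indistinguishability over all
# bipartite multigraph patterns is isomorphism (the top of the `HomIndist` scale)

Helper file (`--supports stmt-ValiantsHypothesis-15886`), def-free.  The graded family `WidthRung d` of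
`Cruxes/MonotoneRestorationQP/Lines/linear_width.lean` carries the width hypothesis
`PolylogHomDetermined f` built from `HomIndist n k A B` ("every homomorphism polynomial `hom_{F,n}` of a
bipartite multigraph pattern `F` of treewidth `< k` takes the same value at `A, B ∈ ℂ^{n×n}`").  The scale
`k ↦ HomIndist n k` is antitone in `k`; this file certifies its TOP: from `k = 4·(n!)²` on,
hom-indistinguishability IS isomorphism of edge-weighted bipartite graphs (same `Sym_n × Sym_n`-orbit),
for ARBITRARY complex weights — Lovász's 1967 theorem ("`hom(·, H)` determines `H`") in the edge-weighted
bipartite setting of the route, with no positivity or genericity assumption (the generic case — pairwise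
distinct row and column sums, caterpillar patterns — is `MomentAlignment.exists_perms_of_moments`).

Mechanism (invariant theory of a finite group, no Möbius inversion / no connection matrices):
* `exists_interpolant` — Lagrange: for a finite set `T` of points and `A ∉ T` there is a polynomial of
  total degree `≤ |T|` equal to `1` at `A` and `0` on `T` (product of affine forms, one per point);
* `exists_matrixSymmetric_separating` — ORBIT SEPARATION: if `B` is not a row/column permutation of `A`,
  the Reynolds sum over `Sym_n × Sym_n` of the interpolant at `A` for `T = (orbit A ∪ orbit B) ∖ {A}` is a
  matrix-symmetric polynomial of degree `< 2·(n!)²` taking the value `|Stab A| ≠ 0` at `A` and `0` at `B`;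
* `exists_homPoly_separating` — with the landed spanning theorem
  `HomSpan.mem_span_homPoly_of_matrixSymmetric` (matrix-symmetric polynomials are `ℂ`-combinations of
  homomorphism polynomials of patterns with `≤ deg` vertices a side and `≤ deg` edges) some `hom_{F,n}`
  with `< 2·(n!)²` vertices a side separates `A` from `B`;
* `exists_perms_of_homIndist` / `homIndist_iff_exists_perms` — THE THEOREM in the line's vocabulary
  (`HomIndist` and `patternGraph` unfolded verbatim): for `N ≥ 4·(n!)²`, `HomIndist n N A B` iff
  `B = A ∘ (σ × τ)` for some `σ, τ ∈ Sym_n` (treewidth `≤` number of vertices `- 1`,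
  `treewidth_le_card_sub_one`; the converse is `rename_perm_homPoly`);
* `eval_eq_of_homIndist_of_matrixSymmetric` — hence EVERY matrix-symmetric polynomial is determined by
  `HomIndist n N`, `N ≥ 4·(n!)²`: at a fixed level the width hypothesis of `WidthRung` has content only
  through the growth rate `(log₂ n + c)^c` of the treewidth bound, never through the level itself.

Honest label: calibration of the line's width scale (its top), classical theorem newly available in the
tree; no stub closed; VP ≠ VNP not moved. [cite: DwivediPagoSeppelt2026, §8 (Lemma 8.18)]
-/

-- `Summit.ValiantsHypothesis.ValiantsHypothesis.…` is the tree's mandated namespace (Sub = Summit).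
set_option linter.dupNamespace false

noncomputable section

namespace Summit.ValiantsHypothesis.ValiantsHypothesis.Theorems

namespace OrbitSeparation

open Literature.Computability.AlgebraicComplexity MvPolynomial

/-! ### Lagrange interpolants on a finite point set -/

/-- **Lagrange interpolant.**  For a finite set `T` of points of `K^ι` and a point `A ∉ T` there is a
polynomial of total degree `≤ |T|` with value `1` at `A` vanishing on `T` (a product of affine forms, one
for each point of `T`, in a coordinate where that point differs from `A`). [folklore] -/
theorem exists_interpolant {K : Type*} [Field K] {ι : Type*} (A : ι → K) (T : Finset (ι → K))
    (hA : A ∉ T) :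
    ∃ p : MvPolynomial ι K, eval A p = 1 ∧ (∀ M ∈ T, eval M p = 0) ∧ p.totalDegree ≤ T.card := by
  classical
  induction T using Finset.induction_on with
  | empty => exact ⟨1, by simp, by simp, by simp⟩
  | @insert M T hMT ih =>
    obtain ⟨p, hpA, hpT, hdeg⟩ := ih fun h => hA (Finset.mem_insert_of_mem h)
    have hMA : M ≠ A := fun h => hA (h ▸ Finset.mem_insert_self M T)
    obtain ⟨i, hi⟩ : ∃ i, M i ≠ A i := by
      by_contra h
      push Not at h
      exact hMA (funext h)
    have hAi : A i - M i ≠ 0 := sub_ne_zero.2 (Ne.symm hi)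
    refine ⟨p * (C (A i - M i)⁻¹ * (X i - C (M i))), ?_, ?_, ?_⟩
    · simp [hpA, hAi]
    · intro M' hM'
      rcases Finset.mem_insert.1 hM' with rfl | hM'
      · simp
      · simp [hpT M' hM']
    · have h1 : (C (A i - M i)⁻¹ * (X i - C (M i)) : MvPolynomial ι K).totalDegree ≤ 1 :=
        calc (C (A i - M i)⁻¹ * (X i - C (M i)) : MvPolynomial ι K).totalDegree
            ≤ (C (A i - M i)⁻¹ : MvPolynomial ι K).totalDegree +
                (X i - C (M i) : MvPolynomial ι K).totalDegree := totalDegree_mul _ _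
          _ ≤ 0 + max (X i : MvPolynomial ι K).totalDegree (C (M i) : MvPolynomial ι K).totalDegree :=
              Nat.add_le_add (totalDegree_C _).le (totalDegree_sub _ _)
          _ ≤ 1 := by simp [totalDegree_X]
      calc (p * (C (A i - M i)⁻¹ * (X i - C (M i)))).totalDegree
          ≤ p.totalDegree + (C (A i - M i)⁻¹ * (X i - C (M i)) : MvPolynomial ι K).totalDegree :=
            totalDegree_mul _ _
        _ ≤ T.card + 1 := Nat.add_le_add hdeg h1
        _ = (insert M T).card := (Finset.card_insert_of_notMem hMT).symm

/-! ### Orbit separation by matrix-symmetric polynomials -/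

variable {n : ℕ}

/-- If `B ∘ (σ × τ) = A` then `B` is a row/column permutation of `A`. [folklore] -/
theorem eq_perm_of_comp_eq (A B : Fin n × Fin n → ℂ) (g : Equiv.Perm (Fin n) × Equiv.Perm (Fin n))
    (h : (B ∘ fun ij : Fin n × Fin n => (g.1 ij.1, g.2 ij.2)) = A) :
    B = fun ij : Fin n × Fin n => A (g.1⁻¹ ij.1, g.2⁻¹ ij.2) := by
  funext ij
  have := congrFun h (g.1⁻¹ ij.1, g.2⁻¹ ij.2)
  simpa using this

/-- **Orbit separation.**  If `B ∈ ℂ^{n×n}` is not obtained from `A` by permuting rows and columns, some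
polynomial invariant under independent row and column permutations, of total degree `< 2·(n!)²`, takes
different values at `A` and `B` (the Reynolds sum of a Lagrange interpolant: value `|Stab A|` at `A`,
`0` at `B`). [folklore] -/
theorem exists_matrixSymmetric_separating (A B : Fin n × Fin n → ℂ)
    (hAB : ∀ σ τ : Equiv.Perm (Fin n), B ≠ fun ij : Fin n × Fin n => A (σ ij.1, τ ij.2)) :
    ∃ q : MvPolynomial (Fin n × Fin n) ℂ,
      (∀ σ τ : Equiv.Perm (Fin n), rename (fun ij : Fin n × Fin n => (σ ij.1, τ ij.2)) q = q) ∧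
      eval A q ≠ eval B q ∧ q.totalDegree < 2 * (Nat.factorial n) ^ 2 := by
  classical
  let G := Equiv.Perm (Fin n) × Equiv.Perm (Fin n)
  let act : G → Fin n × Fin n → Fin n × Fin n := fun g ij => (g.1 ij.1, g.2 ij.2)
  let T : Finset (Fin n × Fin n → ℂ) :=
    (Finset.univ.image fun g : G => A ∘ act g) ∪ Finset.univ.image fun g : G => B ∘ act g
  have hAT : A ∈ T := Finset.mem_union_left _ (Finset.mem_image.2 ⟨1, Finset.mem_univ _, by
    funext ij; simp [act]⟩)
  obtain ⟨p, hpA, hpT, hdeg⟩ := exists_interpolant A (T.erase A) (Finset.notMem_erase A T)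
  have hBact : ∀ g : G, B ∘ act g ≠ A := fun g h => hAB _ _ (eq_perm_of_comp_eq A B g h)
  refine ⟨∑ g : G, rename (act g) p, fun σ τ => ?_, ?_, ?_⟩
  · simp only [map_sum, rename_rename]
    refine Fintype.sum_equiv (Equiv.mulLeft ((σ, τ) : G)) _ _ fun g => ?_
    congr 1
  · have hB : eval B (∑ g : G, rename (act g) p) = 0 := by
      simp only [map_sum, eval_rename]
      refine Finset.sum_eq_zero fun g _ => hpT _ (Finset.mem_erase.2 ⟨hBact g, ?_⟩)
      exact Finset.mem_union_right _ (Finset.mem_image.2 ⟨g, Finset.mem_univ _, rfl⟩)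
    have hA : eval A (∑ g : G, rename (act g) p) =
        ((Finset.univ.filter fun g : G => A ∘ act g = A).card : ℂ) := by
      simp only [map_sum, eval_rename]
      rw [← Finset.sum_filter_add_sum_filter_not Finset.univ (fun g : G => A ∘ act g = A),
        Finset.sum_congr rfl (fun g hg => by rw [(Finset.mem_filter.1 hg).2, hpA]),
        Finset.sum_congr rfl (fun g hg => hpT _ (Finset.mem_erase.2 ⟨(Finset.mem_filter.1 hg).2,
          Finset.mem_union_left _ (Finset.mem_image.2 ⟨g, Finset.mem_univ _, rfl⟩)⟩))]
      simp
    have hpos : 0 < (Finset.univ.filter fun g : G => A ∘ act g = A).card :=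
      Finset.card_pos.2 ⟨1, Finset.mem_filter.2 ⟨Finset.mem_univ _, by funext ij; simp [act]⟩⟩
    rw [hA, hB]
    exact_mod_cast hpos.ne'
  · have hT : T.card ≤ 2 * (Nat.factorial n) ^ 2 :=
      calc T.card ≤ (Finset.univ.image fun g : G => A ∘ act g).card +
            (Finset.univ.image fun g : G => B ∘ act g).card := Finset.card_union_le _ _
        _ ≤ Fintype.card G + Fintype.card G :=
            Nat.add_le_add (Finset.card_image_le.trans (Finset.card_univ (α := G)).le)
              (Finset.card_image_le.trans (Finset.card_univ (α := G)).le)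
        _ = 2 * (Nat.factorial n) ^ 2 := by
            simp only [G, Fintype.card_prod, Fintype.card_perm, Fintype.card_fin]; ring
    have hT0 : (T.erase A).card < 2 * (Nat.factorial n) ^ 2 := by
      rw [Finset.card_erase_of_mem hAT]
      have := Finset.card_pos.2 ⟨A, hAT⟩
      omega
    calc (∑ g : G, rename (act g) p).totalDegree
        ≤ Finset.univ.sup fun g : G => (rename (act g) p).totalDegree := totalDegree_finsetSum _ _
      _ ≤ p.totalDegree := Finset.sup_le fun g _ => totalDegree_rename_le _ _
      _ < 2 * (Nat.factorial n) ^ 2 := hdeg.trans_lt hT0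

/-! ### Separation by homomorphism polynomials (with the spanning theorem) -/

/-- **Some homomorphism polynomial separates non-isomorphic edge-weighted bipartite graphs.**  If `B` is
not a row/column permutation of `A`, then `hom_{F,n}(A) ≠ hom_{F,n}(B)` for a bipartite multigraph pattern
`F` with `< 2·(n!)²` vertices on each side and `< 2·(n!)²` edges.
[cite: DwivediPagoSeppelt2026, §8 (Lemma 8.18)] -/
theorem exists_homPoly_separating (A B : Fin n × Fin n → ℂ)
    (hAB : ∀ σ τ : Equiv.Perm (Fin n), B ≠ fun ij : Fin n × Fin n => A (σ ij.1, τ ij.2)) :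
    ∃ (a b : ℕ) (E : Multiset (Fin a × Fin b)),
      a < 2 * (Nat.factorial n) ^ 2 ∧ b < 2 * (Nat.factorial n) ^ 2 ∧
      Multiset.card E < 2 * (Nat.factorial n) ^ 2 ∧
      eval A (homPoly E n ℂ) ≠ eval B (homPoly E n ℂ) := by
  obtain ⟨q, hq, hsep, hdeg⟩ := exists_matrixSymmetric_separating A B hAB
  by_contra h
  push Not at h
  apply hsep
  refine Submodule.span_induction (p := fun r _ => eval A r = eval B r) ?_ (by simp)
    (fun x y _ _ hx hy => by simp [hx, hy]) (fun c x _ hx => by simp [hx])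
    (HomSpan.mem_span_homPoly_of_matrixSymmetric q hq)
  rintro r ⟨a, b, E, ha, hb, hE, rfl⟩
  exact h a b E (by omega) (by omega) (by omega)

/-- Row/column permutations do not change the values of homomorphism polynomials (they are
matrix-symmetric, `rename_perm_homPoly`). [cite: DwivediPagoSeppelt2026, §1] -/
theorem eval_homPoly_perm (A : Fin n × Fin n → ℂ) (σ τ : Equiv.Perm (Fin n)) {a b : ℕ}
    (E : Multiset (Fin a × Fin b)) :
    eval (fun ij : Fin n × Fin n => A (σ ij.1, τ ij.2)) (homPoly E n ℂ) = eval A (homPoly E n ℂ) := by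
  conv_rhs => rw [← rename_perm_homPoly E n ℂ σ τ]
  rw [eval_rename]
  rfl

/-! ### The theorem in the vocabulary of line `linear-width` -/

/-- **Lovász's theorem for complex edge-weighted bipartite graphs, treewidth-graded form.**  For
`N ≥ 4·(n!)²`, two points `A, B ∈ ℂ^{n×n}` that are hom-indistinguishable below treewidth `N`
(`HomIndist n N A B` of line `linear-width`, unfolded verbatim) differ by a row and a column permutation.
[cite: DwivediPagoSeppelt2026, §8 (Lemma 8.18)] -/
theorem exists_perms_of_homIndist {N : ℕ} (hN : 4 * (Nat.factorial n) ^ 2 ≤ N)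
    (A B : Fin n × Fin n → ℂ)
    (hind : ∀ (a b : ℕ) (E : Multiset (Fin a × Fin b)),
      Literature.Combinatorics.SimpleGraph.treewidth
        (SimpleGraph.fromRel fun u v : Fin a ⊕ Fin b => ∃ p ∈ E, u = Sum.inl p.1 ∧ v = Sum.inr p.2) < N →
      eval A (homPoly E n ℂ) = eval B (homPoly E n ℂ)) :
    ∃ σ τ : Equiv.Perm (Fin n), B = fun ij : Fin n × Fin n => A (σ ij.1, τ ij.2) := by
  by_contra h
  push Not at h
  obtain ⟨a, b, E, ha, hb, -, hsep⟩ := exists_homPoly_separating A B h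
  refine hsep (hind a b E ((Literature.Combinatorics.SimpleGraph.treewidth_le_card_sub_one _).trans_lt ?_))
  simp only [Fintype.card_sum, Fintype.card_fin]
  omega

/-- **`HomIndist n N` is isomorphism for `N ≥ 4·(n!)²`** (iff form; the easy direction is the matrix
symmetry of homomorphism polynomials). [cite: DwivediPagoSeppelt2026, §8 (Lemma 8.18)] -/
theorem homIndist_iff_exists_perms {N : ℕ} (hN : 4 * (Nat.factorial n) ^ 2 ≤ N)
    (A B : Fin n × Fin n → ℂ) :
    (∀ (a b : ℕ) (E : Multiset (Fin a × Fin b)),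
      Literature.Combinatorics.SimpleGraph.treewidth
        (SimpleGraph.fromRel fun u v : Fin a ⊕ Fin b => ∃ p ∈ E, u = Sum.inl p.1 ∧ v = Sum.inr p.2) < N →
      eval A (homPoly E n ℂ) = eval B (homPoly E n ℂ)) ↔
    ∃ σ τ : Equiv.Perm (Fin n), B = fun ij : Fin n × Fin n => A (σ ij.1, τ ij.2) := by
  refine ⟨exists_perms_of_homIndist hN A B, ?_⟩
  rintro ⟨σ, τ, rfl⟩ a b E -
  exact (eval_homPoly_perm A σ τ E).symm

/-- **Hom-indistinguishability over all bipartite multigraph patterns is isomorphism** (threshold-free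
form). [cite: DwivediPagoSeppelt2026, §8 (Lemma 8.18)] -/
theorem forall_eval_homPoly_eq_iff_exists_perms (A B : Fin n × Fin n → ℂ) :
    (∀ (a b : ℕ) (E : Multiset (Fin a × Fin b)), eval A (homPoly E n ℂ) = eval B (homPoly E n ℂ)) ↔
    ∃ σ τ : Equiv.Perm (Fin n), B = fun ij : Fin n × Fin n => A (σ ij.1, τ ij.2) := by
  refine ⟨fun h => exists_perms_of_homIndist le_rfl A B fun a b E _ => h a b E, ?_⟩
  rintro ⟨σ, τ, rfl⟩ a b E
  exact (eval_homPoly_perm A σ τ E).symm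

/-- **Every matrix-symmetric polynomial is determined by `HomIndist n N`, `N ≥ 4·(n!)²`.**  So at a fixed
level `n` the width hypothesis `PolylogHomDetermined` of line `linear-width` constrains a matrix-symmetric
family only in so far as `(log₂ n + c)^c < 4·(n!)²`. [folklore] -/
theorem eval_eq_of_homIndist_of_matrixSymmetric (F : MvPolynomial (Fin n × Fin n) ℂ)
    (hF : ∀ σ τ : Equiv.Perm (Fin n), rename (fun ij : Fin n × Fin n => (σ ij.1, τ ij.2)) F = F)
    {N : ℕ} (hN : 4 * (Nat.factorial n) ^ 2 ≤ N) (A B : Fin n × Fin n → ℂ)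
    (hind : ∀ (a b : ℕ) (E : Multiset (Fin a × Fin b)),
      Literature.Combinatorics.SimpleGraph.treewidth
        (SimpleGraph.fromRel fun u v : Fin a ⊕ Fin b => ∃ p ∈ E, u = Sum.inl p.1 ∧ v = Sum.inr p.2) < N →
      eval A (homPoly E n ℂ) = eval B (homPoly E n ℂ)) :
    eval A F = eval B F := by
  obtain ⟨σ, τ, rfl⟩ := exists_perms_of_homIndist hN A B hind
  conv_lhs => rw [← hF σ τ]
  rw [eval_rename]
  rfl

end OrbitSeparation

end Summit.ValiantsHypothesis.ValiantsHypothesis.Theorems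

end
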